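import Literature.MathematicalPhysics.QuantumFieldTheory.Balaban1983to89.B9Eq340TaxiTelescope
import Literature.MathematicalPhysics.QuantumFieldTheory.Balaban1983to89.B9Eq340NearPairBlocks
import Literature.MathematicalPhysics.QuantumFieldTheory.Balaban1983to89.B9CoReadingCoordsHolder
import Literature.MathematicalPhysics.QuantumFieldTheory.Balaban1983to89.B9Thm312WholeClasses

/-!
# `Balaban1983to89.B9Thm33G0ProbeZeroAtPinsAdm` — T. Bałaban, *Propagators for lattice gauge theories in a background field*, Commun. Math. Phys. **99** (1985) 389–434
# [Balaban1985BackgroundPropagators], Theorem 3.3 for `G₀ = G(U)` (p. 422) read through the Hölder quotients (3.40) p. 397: THE ZEROTH-ORDER HÖLDER PROBES OF `G₀` AT def-Y's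
# PROBE FAMILY `holderProbesK`, FROM THE SUP BOUNDS (3.42)₁,₂ — the PAIR probes at every ADMISSIBLE pair, the POINT and TRANSPORTED-POINT probes at every index, each
# `≤ O(1)·(Lʲη)^{2−β}·e^{−δ₀ d(y,y′)}·|μ|` with a member-uniform `O(1)` (the β-interpolation step of p. 423 for the face `Thm33G0DirX.pX0` of the N06 certificate)

statement-level skeleton of published theorems with citation tags; proofs where landed; nothing here is a claim about the Yang–Mills mass gap

THE PRINT.  (3.40) p. 397 (the covariant Hölder quotient over `x, x′ ∈ Δ̃(y)`, `|x − x′| ≦ 1`, along *"a shortest contour Γ_{x,x′}"*); (3.42) p. 397 (`|G₀λ|`, `|∇_UG₀λ|` on `Δ(y)` for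
`supp λ ⊂ Δ(y′)`); Theorem 3.3 p. 399 and p. 422 (*"Theorem 3.3 for G₀"*); p. 423 (Theorem 3.12: the Hölder member of a *"first factor"* read off the sup bounds).

WHY THIS FILE (cell `pub-ymgap`, Track A node N06 [B9], WIDTH-209 piece 1 = W-c, face `hX = Thm33G0DirX` of the certificate of record, seat `pub-ymgap-dag-n06-w6`).  The displayed
binder `hX` asks for `Thm33G0DirX.pX0 β : HasMaj 𝔠⁽⁰⁾ 𝔠_P^{(β−2)} (Φ^X_β(U) ∘ G₀(U)) (Bx0(β)·e^{−δ₀d})` at the pins `𝔭A x = holderProbesK … parB (bI x)`, `(𝔬12 x).blk = blkBK (bI x)`,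
`(𝔡A x).Dd U μ = coordOpK b (fun _ => cdBₗ U μ)`; probe by probe this reads `|Φ^X_β(U)(G₀μ)(p)| ≤ Bx0(β)·len(y)^{2−β}·e^{−δ₀ d(y,y′)}·|μ|` for `p` anchored at `y`,
`supp μ ⊂ Δ(y′)`.  THIS FILE proves that inequality, with a member-uniform constant, for every POINT probe and every TRANSPORTED-POINT probe (from (3.42)₁ alone) and for the
PAIR probes at the ADMISSIBLE pairs `Adm i x x′` (`x ∥ x′`, `|x − x′|_∞ ≤ L^{j(y(x))}`; from (3.42)₂ along the taxicab contour: `B9Eq340TaxiTelescope` + the near-pair block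
bookkeeping `B9Eq340NearPairBlocks`).  The pair probes at NON-admissible (far) pairs of the index set `PK` are NOT bounded here (LOCATED on the cell bus: they are not
member-uniformly bounded by `e^{−δ₀ d(y(x),y′)}`; the consumer `holderQB_le_of_probes` never reads them).

WHAT IS PROVED (sorry-free; theorems only; the input majorants are HYPOTHESES of the printed (3.42) shape on the coordinate model, as the certificate derives them).
* §1 `norm_assembleK_le` (a slice is `≤ basisBound·(max coordinate)`), `cdB_assembleK` (`∇_{U,μ}` of a slice = the slice of the direction-`μ` coordinate derivative),
  `unitaryLike_one_of`, `unitaryLike_stepRun'`, `unitaryLike_parTaxiV` (def-Y's transporter of unitary-like bond variables is unitary-like — no `NormOneClass` needed),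
  (the reading length is positive: n06's `B9GeoLemma21KLevelV1.geo9K_len_pos`).
* §2 ★ `norm_cdB_slice_G0_le` — at a bond `b′` within the admissible radius of `x`, `‖(∇_{U,μ}Ψ)(b′)‖ ≤ basisBound·B₀·L·e^{δ₀C₀}·len(bI x)·e^{−δ₀ d(bI x, y′)}·|μ|` for the slice
  `Ψ = assembleK ν c′ (G₀μ)`, from the (3.42)₂-type majorant of `∇_{U,μ} ∘ G₀` and `near_len_carrier_le ∕ near_exp_carrier_le` (`C₀ = (d+1)(L+1)+2`).
* §3 ★★★ `pairProbe_G0_le_of_adm` — THE PAIR PROBE AT AN ADMISSIBLE PAIR: `|Φ^X_β(U)(G₀μ)(inl((x,x′),ν,c,c′))| ≤ CX·len(bI x)^{2−β}·e^{−δ₀ d(bI x,y′)}·|μ|` for `β ≤ 1`,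
  `CX = coordBound·(d+1)·basisBound·B₀·L·e^{δ₀C₀}` (β-INDEPENDENT, member-uniform), by `B9Eq340TaxiTelescope.holderWeight_mul_norm_sub_R_parTaxiV_le_of_rungs_of_le`
  (`pairProbe_G0_le_of_adm'`: the same in the product shape `CX·len^{2−β}·e^{−δ₀d}·M`).
* §5 ★★★ `pX0_of_far` — THE FIELD `Thm33G0DirX.pX0 β` AT THESE PINS MODULO THE FAR PAIR PROBES: if the pair probes at NON-admissible pairs obey the same shape with a constant `C_far`
  (vacuous once the pair weight is cut to `Adm`), then `HasMaj 𝔠⁽⁰⁾ 𝔠_P^{(β−2)} (Φ^X_β(U) ∘ G₀) ((CX + B₀ + coordBound·basisBound·B₀ + C_far)·e^{−δ₀d})` (`β ≤ 1`), by n06-l's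
  `hasMaj_cNormR_of_hasMajorantHom` over §3–§4.
* §4 ★★ `pointProbe_G0_le`, ★★ `transProbe_G0_le` — the point probe `inr(inr(x,ν,c,c′))` (anchored at `bI x`) and the transported point probe `inr(inl((x,x′),ν,c,c′))` (anchored
  at `bI x′`, ANY pair) are `≤ B₀·len^{2−β}·e^{−δ₀d}·|μ|` resp. `≤ coordBound·basisBound·B₀·len^{2−β}·e^{−δ₀d}·|μ|` from the (3.42)₁-type majorant of `G₀` (any real `β`).

HONEST SCOPE.  Finite-dimensional bookkeeping over def-Y's readings; the (3.42)-type majorants of `G₀`, `∇_U G₀` on the coordinate model are displayed HYPOTHESES (the certificate's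
`Thm33G0.e0` ∕ `Thm33G0Dir.e1d` at its pins); nothing of [B9] is asserted; the `HasMaj` shape of `pX0` over the WHOLE probe lattice `PK` is reached only MODULO the far pair probes (§5's displayed
hypothesis `hfar` — the located residual).  COUNT-NEUTRAL; N06 NOT discharged; one finite torus at a time; nothing continuum, nothing about the mass gap.  Cell `pub-ymgap` (HUMAN RULING D-0062), Track A node
N06 [B9], seat `pub-ymgap-dag-n06-w6` (g0), 2026-08-28; a NEW file.
-/

namespace Literature.MathematicalPhysics.QuantumFieldTheory.Balaban1983to89.B9Thm33G0ProbeZeroAtPinsAdm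

open LatticeFieldCalculus (supDist)
open B9Eq39Adjoint (R covD)
open B9BackgroundsKLevelV1 (CfgV1 shiftsV1)
open B6GlobalChartV1 (PV blkV1 domT)
open B6Ineq2142KLevelV1 (β lvl)
open B6KLevelCensusIndexV1 (KIdx Adm kGeo len_eq)
open B6Geom246MultiLevelTorus (geomT)
open B6RandomWalk (BlockSupp HasMajorant)
open B6RandomWalkHom (HasMajorantHom)
open B9Thm34Ext (toB6)
open B9GeoNormsKLevelV1 (geo9K)
open B9GeoLemma21KLevelV1 (geo9K_len_pos)
open B9Thm39ReadingCoords (coordBound39 basisBound39 abs_repr_le)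
open B9CoReadingCoords (assembleK assembleK_coordOpK coordOpK XBK blkBK cdBₗ cdBₗ_apply)
open B9CoReadingCoordsHolder (PK blkPK probeK probeK_inl probeK_inr_inl probeK_inr_inr wK w₀K wK_nonneg w₀K_nonneg holderProbesK)
open Node00 (FBondY IBondY CfgY BondParY cdB parBY parTaxiV)
open B9Eq340StepLasso (stepRun rungSites taxiSteps parTaxiV_eq_stepRun)
open B9Eq340TaxiTelescope (holderWeight_mul_norm_sub_R_parTaxiV_le_of_rungs_of_le supDist_rungSites_taxiSteps_le norm_covD_slice_eq norm_R_le)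
open B9Eq340NearPairBlocks (near_len_carrier_le near_exp_carrier_le)
open T4RelativeLadder (UnitaryLike)
open B9Thm312Whole (GeoOK)
open B9Thm312WholeClasses (cNormR hasMaj_cNormR_of_hasMajorantHom)
open B11SectG (HasMaj)

noncomputable section

variable {d ℓ : ℕ} {hd : 1 ≤ d + 1} {hL : Odd (ℓ + 1) ∧ 1 < ℓ + 1} {b₀ b₁ : ℝ}
variable {𝔸 : Type} [NormedRing 𝔸] [NormedAlgebra ℂ 𝔸] [CompleteSpace 𝔸]
variable {κ : Type} [Fintype κ]

/-! ## §1 Slices of coordinate vectors; unitary-like transporters -/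

section Slices

variable {S D : Type} (b : Module.Basis κ ℝ 𝔸)

omit [CompleteSpace 𝔸] in
/-- a re-assembled slice is dominated by its coordinates: `‖Σ_a F(z,ν,a,c′)·b_a‖ ≤ (Σ_a ‖b_a‖)·M` when every `|F(z,ν,a,c′)| ≤ M`.
[cite: Balaban1985BackgroundPropagators, (3.39) p.397 (|A| = max sup |A_μ(x)|), dictionary] -/
theorem norm_assembleK_le (ν : D) (c' : κ) (F : S × D × κ × κ → ℝ) (z : S) {M : ℝ} (hM : ∀ a : κ, |F (z, ν, a, c')| ≤ M) :
    ‖assembleK b ν c' F z‖ ≤ basisBound39 b * M := by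
  unfold assembleK
  calc ‖∑ a, F (z, ν, a, c') • b a‖ ≤ ∑ a, ‖F (z, ν, a, c') • b a‖ := norm_sum_le _ _
    _ = ∑ a, |F (z, ν, a, c')| * ‖b a‖ := by simp [norm_smul]
    _ ≤ ∑ a, M * ‖b a‖ := Finset.sum_le_sum fun a _ => mul_le_mul_of_nonneg_right (hM a) (norm_nonneg _)
    _ = basisBound39 b * M := by rw [← Finset.mul_sum, basisBound39, mul_comm]

end Slices

section Index

variable (i : KIdx d ℓ hd hL b₀ b₁) (b : Module.Basis κ ℝ 𝔸)


/-- **`∇_{U,μ}` OF A SLICE IS THE SLICE OF THE DIRECTION-`μ` COORDINATE DERIVATIVE** (the certificate's pin `(𝔡A x).Dd U μ = coordOpK b (fun _ => cdBₗ U μ)`, read slice-wise).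
[cite: Balaban1985BackgroundPropagators, (3.3) p.391, (3.42) p.397, dictionary] -/
theorem cdB_assembleK (U : CfgY 𝔸 i) (μ ν : Fin (d + 1)) (c' : κ) (F : XBK κ i → ℝ) :
    cdB i U μ (assembleK b ν c' F) = assembleK b ν c' (coordOpK b (fun _ : Fin (d + 1) => cdBₗ i U μ) F) := by
  rw [assembleK_coordOpK, cdBₗ_apply]

omit [NormedAlgebra ℂ 𝔸] [CompleteSpace 𝔸] in
/-- `1` is unitary-like as soon as ONE unit is (`‖1‖ = ‖uu⁻¹‖ ≤ ‖u‖‖u⁻¹‖ ≤ 1`) — no `NormOneClass` needed. [cite: Balaban1985BackgroundPropagators, (3.35) p.396 (unitary bond variables), folklore] -/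
theorem unitaryLike_one_of {u : 𝔸ˣ} (hu : UnitaryLike u) : UnitaryLike (1 : 𝔸ˣ) := by
  have h1 : ‖((1 : 𝔸ˣ) : 𝔸)‖ ≤ 1 := by
    rw [← mul_inv_cancel u, Units.val_mul]
    exact (norm_mul_le _ _).trans (by nlinarith [hu.1, hu.2, norm_nonneg ((u : 𝔸)), norm_nonneg (((u⁻¹ : 𝔸ˣ) : 𝔸))])
  exact ⟨h1, by rw [inv_one]; exact h1⟩

omit [NormedAlgebra ℂ 𝔸] [CompleteSpace 𝔸] in
/-- a signed step run of unitary-like bond variables is unitary-like (n06-i's `unitaryLike_stepRun` without `NormOneClass`).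
[cite: Balaban1985BackgroundPropagators, (3.40) p.397, (3.35) p.396] -/
theorem unitaryLike_stepRun' {P : Params} {U : CfgV1 P 𝔸} (hU : ∀ μ x, UnitaryLike (U μ x)) (h1 : UnitaryLike (1 : 𝔸ˣ)) :
    ∀ (l : List (Fin P.d × Bool)) (w : Site P 0), UnitaryLike (stepRun U l w)
  | [], _ => h1
  | (ν, true) :: l, w => by simp only [stepRun]; exact (hU ν w).mul (unitaryLike_stepRun' hU h1 l _)
  | (ν, false) :: l, w => by simp only [stepRun]; exact (hU ν _).inv.mul (unitaryLike_stepRun' hU h1 l _)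

omit [NormedAlgebra ℂ 𝔸] [CompleteSpace 𝔸] in
/-- ★ def-Y's taxicab transporter `U(Γ_{x,x′})` of unitary-like bond variables is unitary-like (so `R(U(Γ))` does not increase norms).
[cite: Balaban1985BackgroundPropagators, (3.40) p.397, (3.35) p.396] -/
theorem unitaryLike_parTaxiV {P : Params} [Nonempty (Fin P.d)] {U : CfgV1 P 𝔸} (hU : ∀ μ x, UnitaryLike (U μ x)) (x z : Site P 0) :
    UnitaryLike (parTaxiV U x z) := by
  rw [parTaxiV_eq_stepRun]
  exact unitaryLike_stepRun' hU (unitaryLike_one_of (hU (Classical.arbitrary _) x)) _ x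

end Index

/-! ## §2 The covariant derivative of a slice of `G₀μ` at a bond within the admissible radius -/

section Rung

variable (i : KIdx d ℓ hd hL b₀ b₁) (b : Module.Basis κ ℝ 𝔸) [FiniteDimensional ℝ 𝔸] [Fintype (geo9K i).Site]

omit [FiniteDimensional ℝ 𝔸] in
/-- ★ **THE (3.42)₂ INPUT ALONG THE CONTOUR, MOVED TO THE ANCHOR**: let `G₀` be an ℝ-linear operator on the coordinate carrier whose direction-`μ` derivative `∇_{U,μ} ∘ G₀` has the
two-space majorant `B₀·len·e^{−δ₀d}` over the carrier blocks `bI` ((3.42)₂ in the coordinate model), and `supp μv ⊂` block `y′`, `|μv| ≤ M`.  Then for every bond `b′` within the admissible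
radius of `x` (`|x − b′|_∞ ≤ L^{j(y(x))}`) the slice `Ψ = assembleK ν c′ (G₀μv)` has `‖(∇_{U,μ}Ψ)(b′)‖ ≤ basisBound·B₀·L·e^{δ₀((d+1)(L+1)+2)}·len(bI x)·e^{−δ₀ d(bI x, y′)}·M` (pins `hlev`, `hβ1`).
[cite: Balaban1985BackgroundPropagators, (3.42) p.397, (3.40) p.397 (x, x′ ∈ Δ̃(y)); Balaban1984PropagatorsII, (2.46) p.231, (2.51) p.232] -/
theorem norm_cdB_slice_G0_le {B : B9.Backgrounds} (cfg : B.Cfg → CfgY 𝔸 i) (U₁ : B.Cfg) {bI : FBondY i → IBondY i}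
    (hlev : ∀ x : FBondY i, lvl i.hN i.D i.hk (bI x) = (blkV1 i.hN i.D x).1.1)
    (hβ1 : ∀ x : FBondY i, (geomT i.D).dist (β i.hN i.D i.hk (bI x)) (blkV1 i.hN i.D x) ≤ 1)
    {R₀ : ℝ} {H₀ : Prop} (G0 : (XBK κ i → ℝ) →ₗ[ℝ] (XBK κ i → ℝ)) {B₀ δ₀ : ℝ} (hB₀ : 0 ≤ B₀) (hδ₀ : 0 ≤ δ₀) (μ : Fin (d + 1))
    (he1d : HasMajorantHom (g := toB6 (geo9K i) R₀ H₀) (blkBK i bI) (blkBK i bI) (coordOpK b (fun _ : Fin (d + 1) => cdBₗ i (cfg U₁) μ) ∘ₗ G0)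
      (fun a b' => B₀ * (geo9K i).len a * Real.exp (-(δ₀ * (geo9K i).dist a b'))))
    {y' : IBondY i} {μv : XBK κ i → ℝ} {M : ℝ} (hμ : BlockSupp (g := toB6 (geo9K i) R₀ H₀) (blkBK i bI) μv y' M)
    {x b' : FBondY i} (hnear : supDist x.src b'.src ≤ (ℓ + 1) ^ (blkV1 i.hN i.D x).1.1) (ν : Fin (d + 1)) (c' : κ) :
    ‖cdB i (cfg U₁) μ (assembleK b ν c' (G0 μv)) b'‖ ≤
      basisBound39 b * (B₀ * ((ℓ : ℝ) + 1) * Real.exp (δ₀ * (((d : ℝ) + 1) * (((ℓ : ℝ) + 1) + 1) + 2)) *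
        (geo9K i).len (bI x) * Real.exp (-(δ₀ * (geo9K i).dist (bI x) y')) * M) := by
  rw [cdB_assembleK]
  refine norm_assembleK_le b ν c' _ b' fun a => ?_
  -- the (3.42)₂ majorant at the index `(b′, ν, a, c′)`, block `bI b′`
  have h1 := he1d y' μv M hμ (b', ν, a, c')
  have hM : 0 ≤ M := hμ.nonneg
  -- move length and kernel from `bI b′` to `bI x`
  have hlen := (near_len_carrier_le i hlev hnear).1
  have hexp := near_exp_carrier_le i hβ1 hnear hδ₀ y'
  have hlen0 : 0 ≤ (geo9K i).len (bI x) := le_of_lt (geo9K_len_pos i (bI x))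
  have hE := Real.exp_nonneg (-(δ₀ * (geo9K i).dist (bI x) y'))
  have hE0 := Real.exp_nonneg (δ₀ * (((d : ℝ) + 1) * (((ℓ : ℝ) + 1) + 1) + 2))
  calc |(coordOpK b (fun _ : Fin (d + 1) => cdBₗ i (cfg U₁) μ) ∘ₗ G0) μv (b', ν, a, c')|
      ≤ B₀ * (geo9K i).len (bI b') * Real.exp (-(δ₀ * (geo9K i).dist (bI b') y')) * M := h1
    _ ≤ B₀ * (((ℓ : ℝ) + 1) * (geo9K i).len (bI x)) *
          (Real.exp (δ₀ * (((d : ℝ) + 1) * (((ℓ : ℝ) + 1) + 1) + 2)) * Real.exp (-(δ₀ * (geo9K i).dist (bI x) y'))) * M := by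
        gcongr
        · exact hlen
        · exact hexp
    _ = B₀ * ((ℓ : ℝ) + 1) * Real.exp (δ₀ * (((d : ℝ) + 1) * (((ℓ : ℝ) + 1) + 1) + 2)) *
          (geo9K i).len (bI x) * Real.exp (-(δ₀ * (geo9K i).dist (bI x) y')) * M := by ring

end Rung

/-! ## §3 The pair probe of `G₀μ` at an admissible pair -/

section Pair

variable (i : KIdx d ℓ hd hL b₀ b₁) (b : Module.Basis κ ℝ 𝔸) [FiniteDimensional ℝ 𝔸] [Fintype (geo9K i).Site]

/-- ★★★ **THE ZEROTH-ORDER HÖLDER PAIR PROBE OF `G₀` AT AN ADMISSIBLE PAIR** (face `Thm33G0DirX.pX0` of the N06 certificate, probe by probe): at the pins `𝔭 = holderProbesK … parB bI`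
with def-Y's genuine transporter (`par = parBY i`), for unitary-like bond variables, an ℝ-linear `G₀` on the coordinate carrier whose every direction derivative `∇_{U,μ} ∘ G₀` has the
(3.42)₂-type majorant `B₀·len·e^{−δ₀d}`, `supp μv ⊂` block `y′` with `|μv| ≤ M`, an ADMISSIBLE pair `(x, x′)` and `β ≤ 1`:
`|Φ^X_β(U)(G₀μv)(inl((x,x′),ν,c,c′))| ≤ coordBound·(d+1)·(basisBound·B₀·L·e^{δ₀((d+1)(L+1)+2)})·len(bI x)^{2−β}·e^{−δ₀ d(bI x,y′)}·M` — the β-interpolate of (3.42)₁,₂ through the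
quotient (3.40) along the taxicab contour (`(|x−x′|η)^{−β}·|x−x′|₁η·sup_Γ|∇_UΨ| ≤ (d+1)(Lʲη)^{1−β}·sup_Γ|∇_UΨ|`), the sup along `Γ ⊂ Δ̃(y)` moved to the anchor block.
[cite: Balaban1985BackgroundPropagators, (3.40) p.397, (3.42) p.397, Thm 3.3 p.399, p.422–423] -/
theorem pairProbe_G0_le_of_adm {B : B9.Backgrounds} (cfg : B.Cfg → CfgY 𝔸 i) {par : BondParY 𝔸 i} (hpar : par = parBY i) (U₁ : B.Cfg)
    (hU : ∀ μ s, UnitaryLike (cfg U₁ μ s)) {bI : FBondY i → IBondY i}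
    (hlev : ∀ x : FBondY i, lvl i.hN i.D i.hk (bI x) = (blkV1 i.hN i.D x).1.1)
    (hβ1 : ∀ x : FBondY i, (geomT i.D).dist (β i.hN i.D i.hk (bI x)) (blkV1 i.hN i.D x) ≤ 1)
    {R₀ : ℝ} {H₀ : Prop} (G0 : (XBK κ i → ℝ) →ₗ[ℝ] (XBK κ i → ℝ)) {B₀ δ₀ : ℝ} (hB₀ : 0 ≤ B₀) (hδ₀ : 0 ≤ δ₀)
    (he1d : ∀ μ : Fin (d + 1), HasMajorantHom (g := toB6 (geo9K i) R₀ H₀) (blkBK i bI) (blkBK i bI)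
      (coordOpK b (fun _ : Fin (d + 1) => cdBₗ i (cfg U₁) μ) ∘ₗ G0) (fun a b' => B₀ * (geo9K i).len a * Real.exp (-(δ₀ * (geo9K i).dist a b'))))
    {y' : IBondY i} {μv : XBK κ i → ℝ} {M : ℝ} (hμ : BlockSupp (g := toB6 (geo9K i) R₀ H₀) (blkBK i bI) μv y' M)
    {x x' : FBondY i} (hadm : Adm i x x') {βh : ℝ} (hβh : βh ≤ 1) (ν : Fin (d + 1)) (c c' : κ) :
    |(holderProbesK i b B cfg par bI).ΦX U₁ βh (G0 μv) (Sum.inl ((x, x'), ν, c, c'))| ≤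
      coordBound39 b * (((d : ℝ) + 1) * (geo9K i).len (bI x) ^ (1 - βh) *
        (basisBound39 b * (B₀ * ((ℓ : ℝ) + 1) * Real.exp (δ₀ * (((d : ℝ) + 1) * (((ℓ : ℝ) + 1) + 1) + 2)) *
          (geo9K i).len (bI x) * Real.exp (-(δ₀ * (geo9K i).dist (bI x) y')) * M))) := by
  subst hpar
  obtain ⟨hdir, hnear, -⟩ := hadm
  -- the slice read by the probe and the transported difference
  set Ψ : FBondY i → 𝔸 := assembleK b ν c' (G0 μv) with hΨ
  have hval : (holderProbesK i b B cfg (parBY i) bI).ΦX U₁ βh (G0 μv) (Sum.inl ((x, x'), ν, c, c')) =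
      wK i βh x x' * b.repr (Ψ x - R (parBY i (cfg U₁) x.src x'.src) (Ψ x')) c := by
    rw [show (holderProbesK i b B cfg (parBY i) bI).ΦX U₁ βh =
        probeK b (fun x x' : FBondY i => parBY i (cfg U₁) x.src x'.src) (wK i βh) (w₀K i βh) from rfl, probeK_inl]
  rw [hval, abs_mul, abs_of_nonneg (wK_nonneg i βh x x')]
  -- constants
  set D₀ : ℝ := basisBound39 b * (B₀ * ((ℓ : ℝ) + 1) * Real.exp (δ₀ * (((d : ℝ) + 1) * (((ℓ : ℝ) + 1) + 1) + 2)) *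
      (geo9K i).len (bI x) * Real.exp (-(δ₀ * (geo9K i).dist (bI x) y')) * M) with hD₀
  have hlen0 : 0 < (geo9K i).len (bI x) := geo9K_len_pos i _
  have hM : 0 ≤ M := hμ.nonneg
  have hbB : 0 ≤ basisBound39 b := Finset.sum_nonneg fun _ _ => norm_nonneg _
  have hD₀0 : 0 ≤ D₀ := by rw [hD₀]; positivity
  have hη : 0 < |i.cf|⁻¹ := inv_pos.mpr (abs_pos.mpr i.hcf)
  -- the admissible radius in the reading's length: `|x − x′|_∞·|c_f|⁻¹ ≤ len(bI x)`
  have hrad : (supDist x.src x'.src : ℝ) * |i.cf|⁻¹ ≤ (geo9K i).len (bI x) := by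
    have e : (geo9K i).len (bI x) = (((ℓ + 1 : ℕ) : ℝ)) ^ (blkV1 i.hN i.D x).1.1 * |i.cf|⁻¹ := by
      rw [show (geo9K i).len (bI x) = (kGeo i).len (bI x) from rfl, len_eq, hlev x, div_eq_mul_inv]
    rw [e]
    exact mul_le_mul_of_nonneg_right (by exact_mod_cast hnear) hη.le
  -- the (3.42)₂ input at every rung of the contour, through `norm_covD_slice_eq`
  have hrungs : ∀ r ∈ rungSites (taxiSteps (List.finRange (PV d ℓ i.m i.K hd hL).d) x.src x'.src) x.src,
      ‖covD (shiftsV1 (PV d ℓ i.m i.K hd hL)) (cfg U₁) r.2.1 (fun s => Ψ ⟨s, x.dir⟩) r.1‖ ≤ |i.cf|⁻¹ * D₀ := by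
    intro r hr
    have hv : supDist x.src r.1 ≤ (ℓ + 1) ^ (blkV1 i.hN i.D x).1.1 := ((supDist_rungSites_taxiSteps_le x.src x'.src r hr).1).trans hnear
    rw [norm_covD_slice_eq i (cfg U₁) r.2.1 Ψ ⟨r.1, x.dir⟩]
    refine mul_le_mul_of_nonneg_left ?_ hη.le
    rw [hΨ]
    exact norm_cdB_slice_G0_le i b cfg U₁ hlev hβ1 G0 hB₀ hδ₀ r.2.1 (he1d r.2.1) hμ (x := x) (b' := ⟨r.1, x.dir⟩) hv ν c'
  -- FILE 1: the Hölder-weighted telescoping along def-Y's taxicab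
  have key := holderWeight_mul_norm_sub_R_parTaxiV_le_of_rungs_of_le (P := PV d ℓ i.m i.K hd hL) hU (fun s => Ψ ⟨s, x.dir⟩) hη hD₀0 hβh
    x.src x'.src hrad hrungs
  -- reassemble: `x′ = ⟨x′.src, x.dir⟩`, `parBY = parTaxiV`, the weight is `wK`, `(PV …).d = d + 1`
  have hx' : (⟨x'.src, x.dir⟩ : FBondY i) = x' := by rw [hdir]
  have hPd : (((PV d ℓ i.m i.K hd hL).d : ℕ) : ℝ) = (d : ℝ) + 1 := by
    rw [show (PV d ℓ i.m i.K hd hL).d = d + 1 from rfl, Nat.cast_succ]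
  rw [hx', hPd] at key
  have hw : wK i βh x x' = ((supDist x.src x'.src : ℝ) * |i.cf|⁻¹) ^ (-βh) := rfl
  have hR : R (parBY i (cfg U₁) x.src x'.src) (Ψ x') = R (parTaxiV (cfg U₁) x.src x'.src) (Ψ x') := rfl
  calc wK i βh x x' * |b.repr (Ψ x - R (parBY i (cfg U₁) x.src x'.src) (Ψ x')) c|
      ≤ wK i βh x x' * (coordBound39 b * ‖Ψ x - R (parBY i (cfg U₁) x.src x'.src) (Ψ x')‖) :=
        mul_le_mul_of_nonneg_left (abs_repr_le b _ c) (wK_nonneg i βh x x')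
    _ = coordBound39 b * (((supDist x.src x'.src : ℝ) * |i.cf|⁻¹) ^ (-βh) * ‖Ψ x - R (parTaxiV (cfg U₁) x.src x'.src) (Ψ x')‖) := by
        rw [hw, hR]; ring
    _ ≤ coordBound39 b * (((d : ℝ) + 1) * (geo9K i).len (bI x) ^ (1 - βh) * D₀) :=
        mul_le_mul_of_nonneg_left key (by unfold coordBound39; exact norm_nonneg _)

/-- ★★★ **THE SAME, IN THE SHAPE `CX·len^{2−β}·e^{−δ₀d}·M` OF `pX0`** (`len^{1−β}·len = len^{2−β}`), with the β-independent member-uniform constant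
`CX = coordBound·(d+1)·basisBound·B₀·L·e^{δ₀((d+1)(L+1)+2)}`. [cite: Balaban1985BackgroundPropagators, (3.40) p.397, (3.42) p.397, Thm 3.3 p.399, p.422–423] -/
theorem pairProbe_G0_le_of_adm' {B : B9.Backgrounds} (cfg : B.Cfg → CfgY 𝔸 i) {par : BondParY 𝔸 i} (hpar : par = parBY i) (U₁ : B.Cfg)
    (hU : ∀ μ s, UnitaryLike (cfg U₁ μ s)) {bI : FBondY i → IBondY i}
    (hlev : ∀ x : FBondY i, lvl i.hN i.D i.hk (bI x) = (blkV1 i.hN i.D x).1.1)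
    (hβ1 : ∀ x : FBondY i, (geomT i.D).dist (β i.hN i.D i.hk (bI x)) (blkV1 i.hN i.D x) ≤ 1)
    {R₀ : ℝ} {H₀ : Prop} (G0 : (XBK κ i → ℝ) →ₗ[ℝ] (XBK κ i → ℝ)) {B₀ δ₀ : ℝ} (hB₀ : 0 ≤ B₀) (hδ₀ : 0 ≤ δ₀)
    (he1d : ∀ μ : Fin (d + 1), HasMajorantHom (g := toB6 (geo9K i) R₀ H₀) (blkBK i bI) (blkBK i bI)
      (coordOpK b (fun _ : Fin (d + 1) => cdBₗ i (cfg U₁) μ) ∘ₗ G0) (fun a b' => B₀ * (geo9K i).len a * Real.exp (-(δ₀ * (geo9K i).dist a b'))))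
    {y' : IBondY i} {μv : XBK κ i → ℝ} {M : ℝ} (hμ : BlockSupp (g := toB6 (geo9K i) R₀ H₀) (blkBK i bI) μv y' M)
    {x x' : FBondY i} (hadm : Adm i x x') {βh : ℝ} (hβh : βh ≤ 1) (ν : Fin (d + 1)) (c c' : κ) :
    |(holderProbesK i b B cfg par bI).ΦX U₁ βh (G0 μv) (Sum.inl ((x, x'), ν, c, c'))| ≤
      (coordBound39 b * ((d : ℝ) + 1) * basisBound39 b * B₀ * ((ℓ : ℝ) + 1) * Real.exp (δ₀ * (((d : ℝ) + 1) * (((ℓ : ℝ) + 1) + 1) + 2))) *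
        (geo9K i).len (bI x) ^ (2 - βh) * Real.exp (-(δ₀ * (geo9K i).dist (bI x) y')) * M := by
  refine (pairProbe_G0_le_of_adm i b cfg hpar U₁ hU hlev hβ1 G0 hB₀ hδ₀ he1d hμ hadm hβh ν c c').trans (le_of_eq ?_)
  have hlen0 : 0 < (geo9K i).len (bI x) := geo9K_len_pos i _
  have e : (geo9K i).len (bI x) ^ (2 - βh) = (geo9K i).len (bI x) ^ (1 - βh) * (geo9K i).len (bI x) := by
    rw [show (2 : ℝ) - βh = (1 - βh) + 1 by ring, Real.rpow_add hlen0, Real.rpow_one]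
  rw [e]; ring

end Pair

/-! ## §4 The point probe and the transported point probe of `G₀μ` (any index, any pair) from (3.42)₁ -/

section Point

variable (i : KIdx d ℓ hd hL b₀ b₁) (b : Module.Basis κ ℝ 𝔸) [FiniteDimensional ℝ 𝔸] [Fintype (geo9K i).Site]

omit [NormedAlgebra ℂ 𝔸] [CompleteSpace 𝔸] [Fintype κ] [FiniteDimensional ℝ 𝔸] [Fintype (geo9K i).Site] in
/-- the point weight is the reading length to the `−β`: `w₀K β x = len(bI x)^{−β}` under the level pin. [cite: Balaban1985BackgroundPropagators, (3.41) p.397, bookkeeping] -/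
theorem w₀K_eq_len_rpow {bI : FBondY i → IBondY i} (hlev : ∀ x : FBondY i, lvl i.hN i.D i.hk (bI x) = (blkV1 i.hN i.D x).1.1) (βh : ℝ) (x : FBondY i) :
    w₀K i βh x = (geo9K i).len (bI x) ^ (-βh) := by
  rw [show (geo9K i).len (bI x) = (kGeo i).len (bI x) from rfl, len_eq, hlev x, div_eq_mul_inv]
  rfl

omit [FiniteDimensional ℝ 𝔸] in
/-- ★★ **THE POINT PROBE** `inr(inr(x,ν,c,c′))` (anchored at `bI x`): `|w₀K β x · (G₀μv)(x,ν,c,c′)| ≤ B₀·len(bI x)^{2−β}·e^{−δ₀ d(bI x,y′)}·M` from the (3.42)₁-type majorant of `G₀`.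
[cite: Balaban1985BackgroundPropagators, (3.42) p.397, (3.39)–(3.41) p.397, Thm 3.3 p.399] -/
theorem pointProbe_G0_le {B : B9.Backgrounds} (cfg : B.Cfg → CfgY 𝔸 i) (par : BondParY 𝔸 i) (U₁ : B.Cfg) {bI : FBondY i → IBondY i}
    (hlev : ∀ x : FBondY i, lvl i.hN i.D i.hk (bI x) = (blkV1 i.hN i.D x).1.1)
    {R₀ : ℝ} {H₀ : Prop} (G0 : (XBK κ i → ℝ) →ₗ[ℝ] (XBK κ i → ℝ)) {B₀ δ₀ : ℝ}
    (he0 : HasMajorant (g := toB6 (geo9K i) R₀ H₀) (blkBK i bI) G0 (fun a b' => B₀ * (geo9K i).len a ^ 2 * Real.exp (-(δ₀ * (geo9K i).dist a b'))))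
    {y' : IBondY i} {μv : XBK κ i → ℝ} {M : ℝ} (hμ : BlockSupp (g := toB6 (geo9K i) R₀ H₀) (blkBK i bI) μv y' M)
    (βh : ℝ) (x : FBondY i) (ν : Fin (d + 1)) (c c' : κ) :
    |(holderProbesK i b B cfg par bI).ΦX U₁ βh (G0 μv) (Sum.inr (Sum.inr (x, ν, c, c')))| ≤
      B₀ * (geo9K i).len (bI x) ^ (2 - βh) * Real.exp (-(δ₀ * (geo9K i).dist (bI x) y')) * M := by
  rw [show (holderProbesK i b B cfg par bI).ΦX U₁ βh = probeK b (fun x x' : FBondY i => par (cfg U₁) x.src x'.src) (wK i βh) (w₀K i βh) from rfl,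
    probeK_inr_inr, abs_mul, abs_of_nonneg (w₀K_nonneg i βh x), w₀K_eq_len_rpow i hlev]
  have h1 := he0 y' μv M hμ (x, ν, c, c')
  have hlen0 : 0 < (geo9K i).len (bI x) := geo9K_len_pos i _
  have hw : 0 ≤ (geo9K i).len (bI x) ^ (-βh) := Real.rpow_nonneg hlen0.le _
  have e : (geo9K i).len (bI x) ^ (-βh) * (geo9K i).len (bI x) ^ 2 = (geo9K i).len (bI x) ^ (2 - βh) := by
    rw [show (geo9K i).len (bI x) ^ (2 : ℕ) = (geo9K i).len (bI x) ^ ((2 : ℕ) : ℝ) from (Real.rpow_natCast _ 2).symm, ← Real.rpow_add hlen0]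
    norm_num; ring_nf
  calc (geo9K i).len (bI x) ^ (-βh) * |(G0 μv) (x, ν, c, c')|
      ≤ (geo9K i).len (bI x) ^ (-βh) * (B₀ * (geo9K i).len (bI x) ^ 2 * Real.exp (-(δ₀ * (geo9K i).dist (bI x) y')) * M) :=
        mul_le_mul_of_nonneg_left h1 hw
    _ = B₀ * ((geo9K i).len (bI x) ^ (-βh) * (geo9K i).len (bI x) ^ 2) * Real.exp (-(δ₀ * (geo9K i).dist (bI x) y')) * M := by ring
    _ = B₀ * (geo9K i).len (bI x) ^ (2 - βh) * Real.exp (-(δ₀ * (geo9K i).dist (bI x) y')) * M := by rw [e]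

/-- ★★ **THE TRANSPORTED POINT PROBE** `inr(inl((x,x′),ν,c,c′))` (anchored at `bI x′`, ANY pair, unitary-like transport): `|w₀K β x′ · repr_c(R(U(Γ_{x,x′}))Ψ(x′))| ≤
coordBound·basisBound·B₀·len(bI x′)^{2−β}·e^{−δ₀ d(bI x′,y′)}·M`. [cite: Balaban1985BackgroundPropagators, (3.40) + (3.42) p.397, Thm 3.3 p.399] -/
theorem transProbe_G0_le {B : B9.Backgrounds} (cfg : B.Cfg → CfgY 𝔸 i) {par : BondParY 𝔸 i} (hpar : par = parBY i) (U₁ : B.Cfg)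
    (hU : ∀ μ s, UnitaryLike (cfg U₁ μ s)) {bI : FBondY i → IBondY i}
    (hlev : ∀ x : FBondY i, lvl i.hN i.D i.hk (bI x) = (blkV1 i.hN i.D x).1.1)
    {R₀ : ℝ} {H₀ : Prop} (G0 : (XBK κ i → ℝ) →ₗ[ℝ] (XBK κ i → ℝ)) {B₀ δ₀ : ℝ}
    (he0 : HasMajorant (g := toB6 (geo9K i) R₀ H₀) (blkBK i bI) G0 (fun a b' => B₀ * (geo9K i).len a ^ 2 * Real.exp (-(δ₀ * (geo9K i).dist a b'))))
    {y' : IBondY i} {μv : XBK κ i → ℝ} {M : ℝ} (hμ : BlockSupp (g := toB6 (geo9K i) R₀ H₀) (blkBK i bI) μv y' M)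
    (βh : ℝ) (x x' : FBondY i) (ν : Fin (d + 1)) (c c' : κ) :
    |(holderProbesK i b B cfg par bI).ΦX U₁ βh (G0 μv) (Sum.inr (Sum.inl ((x, x'), ν, c, c')))| ≤
      coordBound39 b * basisBound39 b * B₀ * (geo9K i).len (bI x') ^ (2 - βh) * Real.exp (-(δ₀ * (geo9K i).dist (bI x') y')) * M := by
  subst hpar
  rw [show (holderProbesK i b B cfg (parBY i) bI).ΦX U₁ βh = probeK b (fun x x' : FBondY i => parBY i (cfg U₁) x.src x'.src) (wK i βh) (w₀K i βh) from rfl,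
    probeK_inr_inl, abs_mul, abs_of_nonneg (w₀K_nonneg i βh x'), w₀K_eq_len_rpow i hlev]
  set Ψ : FBondY i → 𝔸 := assembleK b ν c' (G0 μv) with hΨ
  have hlen0 : 0 < (geo9K i).len (bI x') := geo9K_len_pos i _
  have hw : 0 ≤ (geo9K i).len (bI x') ^ (-βh) := Real.rpow_nonneg hlen0.le _
  have hM : 0 ≤ M := hμ.nonneg
  have hcB : 0 ≤ coordBound39 b := by unfold coordBound39; exact norm_nonneg _
  -- `‖R(U(Γ))Ψ(x′)‖ ≤ ‖Ψ(x′)‖ ≤ basisBound·B₀·len(bI x′)²·e^{−δ₀d}·M`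
  haveI : Nonempty (Fin (PV d ℓ i.m i.K hd hL).d) := ⟨⟨0, Nat.succ_pos d⟩⟩
  have hu : UnitaryLike (parBY i (cfg U₁) x.src x'.src) := unitaryLike_parTaxiV hU x.src x'.src
  have hΨ' : ‖Ψ x'‖ ≤ basisBound39 b * (B₀ * (geo9K i).len (bI x') ^ 2 * Real.exp (-(δ₀ * (geo9K i).dist (bI x') y')) * M) :=
    norm_assembleK_le b ν c' _ x' fun a => he0 y' μv M hμ (x', ν, a, c')
  have e : (geo9K i).len (bI x') ^ (-βh) * (geo9K i).len (bI x') ^ 2 = (geo9K i).len (bI x') ^ (2 - βh) := by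
    rw [show (geo9K i).len (bI x') ^ (2 : ℕ) = (geo9K i).len (bI x') ^ ((2 : ℕ) : ℝ) from (Real.rpow_natCast _ 2).symm, ← Real.rpow_add hlen0]
    norm_num; ring_nf
  calc (geo9K i).len (bI x') ^ (-βh) * |b.repr (R (parBY i (cfg U₁) x.src x'.src) (Ψ x')) c|
      ≤ (geo9K i).len (bI x') ^ (-βh) * (coordBound39 b * ‖R (parBY i (cfg U₁) x.src x'.src) (Ψ x')‖) :=
        mul_le_mul_of_nonneg_left (abs_repr_le b _ c) hw
    _ ≤ (geo9K i).len (bI x') ^ (-βh) * (coordBound39 b * ‖Ψ x'‖) :=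
        mul_le_mul_of_nonneg_left (mul_le_mul_of_nonneg_left (norm_R_le hu _) hcB) hw
    _ ≤ (geo9K i).len (bI x') ^ (-βh) * (coordBound39 b *
          (basisBound39 b * (B₀ * (geo9K i).len (bI x') ^ 2 * Real.exp (-(δ₀ * (geo9K i).dist (bI x') y')) * M))) :=
        mul_le_mul_of_nonneg_left (mul_le_mul_of_nonneg_left hΨ' hcB) hw
    _ = coordBound39 b * basisBound39 b * B₀ * ((geo9K i).len (bI x') ^ (-βh) * (geo9K i).len (bI x') ^ 2) *
          Real.exp (-(δ₀ * (geo9K i).dist (bI x') y')) * M := by ring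
    _ = coordBound39 b * basisBound39 b * B₀ * (geo9K i).len (bI x') ^ (2 - βh) * Real.exp (-(δ₀ * (geo9K i).dist (bI x') y')) * M := by rw [e]

end Point

/-! ## §5 The `pX0` shape MODULO the far pair probes -/

section Package

variable (i : KIdx d ℓ hd hL b₀ b₁) (b : Module.Basis κ ℝ 𝔸) [FiniteDimensional ℝ 𝔸] [Fintype (geo9K i).Site]

/-- ★★★ **`pX0` AT THE PINS, MODULO THE FAR PAIR PROBES**: at `𝔭 = holderProbesK … parB bI` (def-Y's genuine transporter, unitary-like bond variables) and for an ℝ-linear `G₀`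
with the (3.42)₁,₂-type majorants `B₀·len²·e^{−δ₀d}` (of `G₀`) and `B₀·len·e^{−δ₀d}` (of every `∇_{U,μ} ∘ G₀`) over the carrier blocks: IF the pair probes at the NON-admissible pairs
obey `|Φ^X_β(U)(G₀μ)(inl((x,x′),…))| ≤ C_far·len(bI x)^{2−β}·e^{−δ₀ d(bI x,y′)}·M` (the located residual — vacuous for a pair weight cut to `Adm`), THEN for `β ≤ 1`
`HasMaj 𝔠⁽⁰⁾ 𝔠_P^{(β−2)} (Φ^X_β(U) ∘ G₀) ((CX + B₀ + coordBound·basisBound·B₀ + C_far)·e^{−δ₀d})` — the field `Thm33G0DirX.pX0 β` at these pins, by n06-l's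
`hasMaj_cNormR_of_hasMajorantHom` over the three faces of §3–§4 and the hypothesis. [cite: Balaban1985BackgroundPropagators, (3.40) + (3.42) p.397, Thm 3.3 p.399, p.422–423] -/
theorem pX0_of_far (hG : GeoOK (geo9K i)) {B : B9.Backgrounds} (cfg : B.Cfg → CfgY 𝔸 i) {par : BondParY 𝔸 i} (hpar : par = parBY i) (U₁ : B.Cfg)
    (hU : ∀ μ s, UnitaryLike (cfg U₁ μ s)) {bI : FBondY i → IBondY i}
    (hlev : ∀ x : FBondY i, lvl i.hN i.D i.hk (bI x) = (blkV1 i.hN i.D x).1.1)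
    (hβ1 : ∀ x : FBondY i, (geomT i.D).dist (β i.hN i.D i.hk (bI x)) (blkV1 i.hN i.D x) ≤ 1)
    {R₀ : ℝ} {H₀ : Prop} (G0 : (XBK κ i → ℝ) →ₗ[ℝ] (XBK κ i → ℝ)) {B₀ δ₀ : ℝ} (hB₀ : 0 ≤ B₀) (hδ₀ : 0 ≤ δ₀)
    (he0 : HasMajorant (g := toB6 (geo9K i) R₀ H₀) (blkBK i bI) G0 (fun a b' => B₀ * (geo9K i).len a ^ 2 * Real.exp (-(δ₀ * (geo9K i).dist a b'))))
    (he1d : ∀ μ : Fin (d + 1), HasMajorantHom (g := toB6 (geo9K i) R₀ H₀) (blkBK i bI) (blkBK i bI)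
      (coordOpK b (fun _ : Fin (d + 1) => cdBₗ i (cfg U₁) μ) ∘ₗ G0) (fun a b' => B₀ * (geo9K i).len a * Real.exp (-(δ₀ * (geo9K i).dist a b'))))
    {βh : ℝ} (hβh : βh ≤ 1) {Cfar : ℝ} (hCfar : 0 ≤ Cfar)
    (hfar : ∀ (y' : IBondY i) (μv : XBK κ i → ℝ) (M : ℝ), BlockSupp (g := toB6 (geo9K i) R₀ H₀) (blkBK i bI) μv y' M →
      ∀ (x x' : FBondY i) (ν : Fin (d + 1)) (c c' : κ), ¬ Adm i x x' →
        |(holderProbesK i b B cfg par bI).ΦX U₁ βh (G0 μv) (Sum.inl ((x, x'), ν, c, c'))| ≤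
          Cfar * (geo9K i).len (bI x) ^ (2 - βh) * Real.exp (-(δ₀ * (geo9K i).dist (bI x) y')) * M) :
    HasMaj (cNormR R₀ H₀ (blkBK i bI) hG.lenle 0) (cNormR R₀ H₀ (blkPK bI) hG.lenle (βh - 2))
      ((holderProbesK i b B cfg par bI).ΦX U₁ βh ∘ₗ G0)
      (fun a b' => (coordBound39 b * ((d : ℝ) + 1) * basisBound39 b * B₀ * ((ℓ : ℝ) + 1) * Real.exp (δ₀ * (((d : ℝ) + 1) * (((ℓ : ℝ) + 1) + 1) + 2)) +
        B₀ + coordBound39 b * basisBound39 b * B₀ + Cfar) * Real.exp (-(δ₀ * (geo9K i).dist a b'))) := by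
  classical
  set CX : ℝ := coordBound39 b * ((d : ℝ) + 1) * basisBound39 b * B₀ * ((ℓ : ℝ) + 1) * Real.exp (δ₀ * (((d : ℝ) + 1) * (((ℓ : ℝ) + 1) + 1) + 2)) with hCX
  set CT : ℝ := coordBound39 b * basisBound39 b * B₀ with hCT
  have hcB : 0 ≤ coordBound39 b := by unfold coordBound39; exact norm_nonneg _
  have hbB : 0 ≤ basisBound39 b := Finset.sum_nonneg fun _ _ => norm_nonneg _
  have hCX0 : 0 ≤ CX := by rw [hCX]; positivity
  have hCT0 : 0 ≤ CT := by rw [hCT]; positivity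
  set Ctot : ℝ := CX + B₀ + CT + Cfar with hCtot
  -- the per-probe two-space majorant with the powers displayed, then n06-l's conversion into the state norms
  have hhom : HasMajorantHom (g := toB6 (geo9K i) R₀ H₀) (blkBK i bI) (blkPK bI) ((holderProbesK i b B cfg par bI).ΦX U₁ βh ∘ₗ G0)
      (fun (a b' : (geo9K i).Site) => Ctot * Real.exp (-(δ₀ * (geo9K i).dist a b')) * (geo9K i).len a ^ (2 - βh) * (geo9K i).len b' ^ (0 : ℝ)) := by
    intro y' μv M hμ q
    have hM : 0 ≤ M := hμ.nonneg
    simp only [Real.rpow_zero, mul_one, LinearMap.comp_apply]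
    -- each face is `≤ (its constant)·len^{2−β}·e^{−δ₀d}·M ≤ Ctot·…`
    have hup : ∀ {C a : ℝ} (y : IBondY i), 0 ≤ C → C ≤ Ctot →
        a ≤ C * (geo9K i).len y ^ (2 - βh) * Real.exp (-(δ₀ * (geo9K i).dist y y')) * M →
        a ≤ Ctot * Real.exp (-(δ₀ * (geo9K i).dist y y')) * (geo9K i).len y ^ (2 - βh) * M := by
      intro C a y hC hCle h
      refine h.trans ?_
      have hl : 0 ≤ (geo9K i).len y ^ (2 - βh) := Real.rpow_nonneg (le_of_lt (geo9K_len_pos i y)) _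
      have hE := Real.exp_nonneg (-(δ₀ * (geo9K i).dist y y'))
      calc C * (geo9K i).len y ^ (2 - βh) * Real.exp (-(δ₀ * (geo9K i).dist y y')) * M
          ≤ Ctot * (geo9K i).len y ^ (2 - βh) * Real.exp (-(δ₀ * (geo9K i).dist y y')) * M := by gcongr
        _ = Ctot * Real.exp (-(δ₀ * (geo9K i).dist y y')) * (geo9K i).len y ^ (2 - βh) * M := by ring
    rcases q with ⟨⟨x, x'⟩, ν, c, c'⟩ | ⟨⟨x, x'⟩, ν, c, c'⟩ | ⟨x, ν, c, c'⟩
    · -- pair probe, anchored at `bI x`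
      show |_| ≤ Ctot * Real.exp (-(δ₀ * (geo9K i).dist (bI x) y')) * (geo9K i).len (bI x) ^ (2 - βh) * M
      by_cases hadm : Adm i x x'
      · exact hup (bI x) hCX0 (by rw [hCtot]; linarith) (pairProbe_G0_le_of_adm' i b cfg hpar U₁ hU hlev hβ1 G0 hB₀ hδ₀ he1d hμ hadm hβh ν c c')
      · exact hup (bI x) hCfar (by rw [hCtot]; linarith) (hfar y' μv M hμ x x' ν c c' hadm)
    · -- transported point probe, anchored at `bI x′`
      show |_| ≤ Ctot * Real.exp (-(δ₀ * (geo9K i).dist (bI x') y')) * (geo9K i).len (bI x') ^ (2 - βh) * M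
      exact hup (bI x') hCT0 (by rw [hCtot]; linarith) (transProbe_G0_le i b cfg hpar U₁ hU hlev G0 he0 hμ βh x x' ν c c')
    · -- point probe, anchored at `bI x`
      show |_| ≤ Ctot * Real.exp (-(δ₀ * (geo9K i).dist (bI x) y')) * (geo9K i).len (bI x) ^ (2 - βh) * M
      exact hup (bI x) hB₀ (by rw [hCtot]; linarith) (pointProbe_G0_le i b cfg par U₁ hlev G0 he0 hμ βh x ν c c')
  have h' := hasMaj_cNormR_of_hasMajorantHom hG (C := fun a b' => Ctot * Real.exp (-(δ₀ * (geo9K i).dist a b')))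
    (fun a b' => mul_nonneg (by rw [hCtot]; linarith) (Real.exp_nonneg _)) (2 - βh) 0 hhom
  have e : -(2 - βh) = βh - 2 := by ring
  rw [e] at h'
  exact h'

end Package

end

end Literature.MathematicalPhysics.QuantumFieldTheory.Balaban1983to89.B9Thm33G0ProbeZeroAtPinsAdm
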